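import Summits.Ventures.PercRepro.MSTightDefect

/-!
# The top member of a tight family sees every near-member

Dossier proofs/MINE1-theoremS.md, Addendum 67 (the product coordinates). For a tight family `F`
the top member `Rstar F` (the union of the addable classes, a member by Theorem S) decides
membership of a set `w` and of its complement by its cells alone:

* if the two agreement cells of `w` at `Rstar F` — `Rstar F ∩ w` and `(Rstar F)ᶜ ∩ wᶜ` — are
  differences, then `wᶜ` is a member (`compl_mem_of_cells_Rstar`);
* if the two disagreement cells — `Rstar F \ w` and `w \ Rstar F` — are differences, then `w` is
  a member (`mem_of_cells_Rstar_compl`).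

Both are the product form of Theorem S read at one member (`union_sdiff_mem_of_tight`). Hence a
set `w` with `w, wᶜ ∉ F` has a defect in each of its two cell pairs at the top member
(`exists_defect_at_Rstar`): Theorem (TL) for tight families is witnessed by `Rstar F` alone, and
in the coloured Marica–Schönheim instances with a tight transversal every pair of the middle
type produces a new element already at the top member.
-/

namespace PercRepro.MSTight

open Finset
open scoped FinsetFamily

variable {α : Type*} [DecidableEq α] [Fintype α]

section TopMember

variable {F : Finset (Finset α)}

/-- **Agreement cells at the top member give the complement.** -/
theorem compl_mem_of_cells_Rstar (hF : Tight F) {w : Finset α}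
    (h : Cells (F \\ F) (Rstar F) w) : univ \ w ∈ F := by
  obtain ⟨h1, h2⟩ := h
  have hmem := union_sdiff_mem_of_tight hF h2 inter_subset_left h1 inter_subset_left
  have e : (univ \ Rstar F) ∩ (univ \ w) ∪ (Rstar F \ (Rstar F ∩ w)) = univ \ w := by
    ext x; simp only [mem_union, mem_inter, mem_sdiff, mem_univ, true_and]; tauto
  rwa [e] at hmem

/-- **Disagreement cells at the top member give the set itself.** -/
theorem mem_of_cells_Rstar_compl (hF : Tight F) {w : Finset α}
    (h : Cells (F \\ F) (Rstar F) (univ \ w)) : w ∈ F := by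
  obtain ⟨h1, h2⟩ := h
  have hmem := union_sdiff_mem_of_tight hF h2 inter_subset_left h1 inter_subset_left
  have e : (univ \ Rstar F) ∩ (univ \ (univ \ w)) ∪ (Rstar F \ (Rstar F ∩ (univ \ w))) = w := by
    ext x; simp only [mem_union, mem_inter, mem_sdiff, mem_univ, true_and, not_not]; tauto
  rwa [e] at hmem

/-- **Every non-member with a non-member complement has a defect in both cell pairs at the top
member**: an agreement cell outside the differences and a disagreement cell outside the
differences. -/
theorem exists_defect_at_Rstar (hF : Tight F) {w : Finset α} (hw : w ∉ F)
    (hwc : univ \ w ∉ F) :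
    (Rstar F ∩ w ∉ F \\ F ∨ (univ \ Rstar F) ∩ (univ \ w) ∉ F \\ F) ∧
      (Rstar F \ w ∉ F \\ F ∨ w \ Rstar F ∉ F \\ F) := by
  constructor
  · by_contra hcon
    rw [not_or, not_not, not_not] at hcon
    exact hwc (compl_mem_of_cells_Rstar hF ⟨hcon.1, hcon.2⟩)
  · by_contra hcon
    rw [not_or, not_not, not_not] at hcon
    apply hw
    refine mem_of_cells_Rstar_compl hF ⟨?_, ?_⟩
    · have e : Rstar F ∩ (univ \ w) = Rstar F \ w := by
        ext x; simp only [mem_inter, mem_sdiff, mem_univ, true_and]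
      rw [e]; exact hcon.1
    · have e : (univ \ Rstar F) ∩ (univ \ (univ \ w)) = w \ Rstar F := by
        ext x; simp only [mem_inter, mem_sdiff, mem_univ, true_and, not_not]; tauto
      rw [e]; exact hcon.2

/-- **The mixed-cell lemma (TL) at the top member alone**: a set whose required cells at `Rstar F`
lie among the differences — agreement cells or disagreement cells — is a member or the
complement of one. -/
theorem mem_or_compl_mem_of_cells_Rstar (hF : Tight F) {w : Finset α}
    (h : Cells (F \\ F) (Rstar F) w ∨ Cells (F \\ F) (Rstar F) (univ \ w)) :
    w ∈ F ∨ univ \ w ∈ F := by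
  rcases h with h | h
  · exact Or.inr (compl_mem_of_cells_Rstar hF h)
  · exact Or.inl (mem_of_cells_Rstar_compl hF h)

end TopMember

end PercRepro.MSTight
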